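import Literature.NumberTheory.GaloisRepresentations.IdeleClassBarModAlphaOneInjective
import Literature.NumberTheory.GaloisRepresentations.IdeleClassBarSubgroupHOne
import Literature.NumberTheory.GaloisRepresentations.IdeleClassGroupLimitLayers
import Literature.Algebra.Homology.DiscreteRepModPairingCofinal
import Literature.Algebra.Homology.DiscreteRepTateDuality
import Literature.Algebra.Homology.DiscreteRepInvariantCores
import HarnessLib

/-!
# `α¹(U, ℤ/m)` for the idèle class formation `(Γ_F, C̄, inv_F)`: the injectivity half of the field
# `adjointBijective_one_zmod` of Tate's duality theorem, at EVERY open normal `U ≤ Γ_F` (Milne ADT I Thm. 1.8 (b))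

Topic `NumberTheory/GaloisRepresentations`; namespace `Literature.NumberTheory.GaloisRepresentations.IdeleClassBar`.
Assembly file of door-c4 g16's Route A (A5)-ARITH chain: `IdeleClassBarInvariantSubgroup` (`inv_U = classBarInvAt`,
`inv_U ∘ res = [Γ:U] • inv_F`), `DiscreteRepModPairingCofinal` (Milne's (b) from the layer identities on a cofinal family),
`IdeleClassBarModAlphaOneInjective` (the layer identities, injectivity side, from door-c6 g14's class field theory),
door-c6 g15's `IdeleClassBarSubgroupHOne` (`Ext¹_{C_U}(ℤ, Res_U C̄) = 0`) and door-c5's `IdeleClassGroupLimitLayers`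
(`GalLayer.ofOpenNormalSubgroup`: every open normal `U` is `U_L`).  Theorems only (no definition, no named fact, no
instance, no notation, no `sorry`).

* `invAt_classData_eq_classBarInvAt` — door-c4 g15's `invAt C̄ inv_F U = inv_F ∘ cores_U` IS `inv_U = classBarInvAt`
  (door-c4 `inv_comp_extCores_eq`).
* **`adjointInjective_one_zmod_classData`** — for every open normal `U ≤ Γ_F` and `m ≥ 1`,
  `α¹(U, ℤ/m) : Ext¹_{C_U}(ℤ/m, Res_U C̄) → Hom(Ext¹_{C_U}(ℤ, ℤ/m), ℚ/ℤ)` is injective (`ExtDuality.AdjointInjective` for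
  `invAt C̄ inv_F U` in bidegree `(1, 1)`); spelling `classBarD F` in `adjointInjective_one_zmod_classBarD`.

What remains for the field `TateDualityHypotheses.adjointBijective_one_zmod` is the surjectivity half (door-c6 g14's
`exists_idele_forall_layer_pairing_eq` for the base `L = F̄^U`, through the same dictionary).

HONEST FRAMING: bookkeeping; the arithmetic is door-c6 g14's (Tate C–F VII, global class field theory); no case of BSD or
of Poitou–Tate is proved.  Route A (A5)-ARITH of crux `AnticycControlAdditiveK` (item 19295, cell bsd-schneider), seat
door-c4 gen 16.

## References
* J. S. Milne, *Arithmetic Duality Theorems* (2nd ed. 2006), I §1 (class formations (1.1)), Theorem 1.8 (b). [MilneADT2006]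
* J. W. S. Cassels, A. Fröhlich (eds.), *Algebraic Number Theory* (1967), Ch. VII (J. Tate) §5.1, §11.3. [CasselsFrohlichANT1967]
* D. Harari, *Galois Cohomology and Class Field Theory* (2020), §16.1 Definition 16.3. [Harari2020]
-/

noncomputable section

open NumberField CategoryTheory groupCohomology
open Field (absoluteGaloisGroup)
open Literature.NumberTheory.Automorphic Literature.NumberTheory.Automorphic.IdeleClassGroup
open Literature.NumberTheory.NumberFields
open Literature.Algebra.Homology Literature.Algebra.Homology.DiscreteRep
open scoped Classical

namespace Literature.NumberTheory.GaloisRepresentations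

namespace IdeleClassBar

variable (F : Type) [Field F] [NumberField F]
variable [CompactSpace (absoluteGaloisGroup F)] [TotallyDisconnectedSpace (absoluteGaloisGroup F)]

/-! ## §33. `invAt C̄ inv_F U = inv_U` -/

/-- `ℚ/ℤ` is divisible: `q = n • q'` for every `n ≥ 1`. [folklore] -/
private theorem exists_eq_nsmul' (n : ℕ) (hn : n ≠ 0) (q : AddCircle (1 : ℚ)) : ∃ q' : AddCircle (1 : ℚ), q = n • q' := by
  induction q using QuotientAddGroup.induction_on with
  | H x =>
    refine ⟨((x / n : ℚ) : AddCircle (1 : ℚ)), ?_⟩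
    rw [← AddCircle.coe_nsmul, nsmul_eq_mul, mul_div_cancel₀ _ (Nat.cast_ne_zero.2 hn)]

/-- **`invAt C̄ inv_F U = inv_U`**: door-c4 g15's local invariant map `inv_F ∘ cores_U` of the class-formation datum
`(C̄, inv_F)` at an open normal `U ≤ Γ_F` is door-c4 g16's `classBarInvAt F U` (the descended family of relative layer
invariants), by `inv_U ∘ res = [Γ:U] • inv_F`, `inv_U` injective, `inv_F` onto and divisibility of `ℚ/ℤ` (door-c4
`inv_comp_extCores_eq`). [cite: MilneADT2006, I §1 (class formations, (1.1))][cite: Harari2020, §16.1 Definition 16.3] -/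
theorem invAt_classData_eq_classBarInvAt (U : OpenNormalSubgroup (absoluteGaloisGroup F)) :
    DiscreteRep.invAt (classData F).toSystem.toD (classBarInvD F) U =
      classBarInvAt F (U : Subgroup (absoluteGaloisGroup F)) (LayerColimit.coe_isOpen U) := by
  haveI := finiteIndex_of_openNormalSubgroup U
  refine AddMonoidHom.ext fun y => ?_
  exact inv_comp_extCores_eq (U : Subgroup (absoluteGaloisGroup F)) U.toOpenSubgroup.isOpen (classData F).toSystem.toD
    (classBarInvD F) (classBarInvAt F (U : Subgroup (absoluteGaloisGroup F)) (LayerColimit.coe_isOpen U))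
    (classBarInvAt_extRes F U) (classBarInvAt_bijective F U).1 (classBarInvD_surjective F)
    (exists_eq_nsmul' _ Subgroup.FiniteIndex.index_ne_zero) y

/-! ## §34. The injectivity half of `α¹(U, ℤ/m)` bijective -/

/-- **`α¹(U, ℤ/m)` is injective for the idèle class formation**, at every open normal `U ≤ Γ_F` and every `m ≥ 1`:
`ExtDuality.AdjointInjective (invAt C̄ inv_F U) (ℤ/m)` in bidegree `(1, 1)` — the injectivity half of the field
`adjointBijective_one_zmod` of `TateDualityHypotheses C̄ inv_F` (`C̄ = (classData F).toSystem.toD`).  Proof: `U = U_L`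
for the layer `L = F̄^U` (door-c5 `GalLayer.ofOpenNormalSubgroup`); door-c4 g16's criterion
`adjointInjective_triv_zmod_of_cofinal` over the trace layers `U_E ∩ U_L` (`E ⊇ L`), with `Ext¹_{C_U}(ℤ, Res C̄) = 0`
(door-c6 g15) and the arithmetic input `exists_nsmul_eq_of_forall_layer_value_eq_zero` (door-c6 g14's class field theory
through door-c4 g16's dictionary). [cite: MilneADT2006, I Theorem 1.8 (b)][cite: CasselsFrohlichANT1967, Ch. VII §11.3, §5.1] -/
theorem adjointInjective_one_zmod_classData (U : OpenNormalSubgroup (absoluteGaloisGroup F)) {m : ℕ} (hm : 0 < m) :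
    ExtDuality.AdjointInjective (DiscreteRep.invAt (classData F).toSystem.toD (classBarInvD F) U)
      (triv (k := ℤ) (Γ := (U : Subgroup (absoluteGaloisGroup F))) (ZMod m)) (show 1 + 1 = 2 from rfl) := by
  -- `U = U_L`
  obtain ⟨L, rfl⟩ : ∃ L : GalLayer F, L.openNormalSubgroup = U :=
    ⟨GalLayer.ofOpenNormalSubgroup U, GalLayer.openNormalSubgroup_ofOpenNormalSubgroup U⟩
  rw [invAt_classData_eq_classBarInvAt]
  exact adjointInjective_triv_zmod_of_cofinal
    ((resD ℤ (L.openNormalSubgroup : Subgroup (absoluteGaloisGroup F))).obj (classData F).toSystem.toD)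
    (classBarInvAt F (L.openNormalSubgroup : Subgroup (absoluteGaloisGroup F)) (LayerColimit.coe_isOpen _)) hm
    (fun x => ext_one_res_classBarD_eq_zero (L.openNormalSubgroup : Subgroup (absoluteGaloisGroup F))
      (LayerColimit.coe_isOpen _) x)
    (fun E : {E : GalLayer F // L ≤ E} =>
      traceOpenNormalSubgroup (L.openNormalSubgroup : Subgroup (absoluteGaloisGroup F)) E.1.openNormalSubgroup)
    (fun φ hφ => exists_nsmul_eq_of_forall_layer_value_eq_zero L hm φ fun E h χ => hφ ⟨E, h⟩ χ)

/-- The same in door-c5's spelling `classBarD F` of `C̄` — verbatim the injectivity half of the field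
`adjointBijective_one_zmod` of `TateDualityHypotheses (classBarD F) (classBarInvD F)`. [cite: MilneADT2006, I Theorem 1.8 (b)] -/
theorem adjointInjective_one_zmod_classBarD (U : OpenNormalSubgroup (absoluteGaloisGroup F)) {m : ℕ} (hm : 0 < m) :
    ExtDuality.AdjointInjective (DiscreteRep.invAt (classBarD F) (classBarInvD F) U)
      (triv (k := ℤ) (Γ := (U : Subgroup (absoluteGaloisGroup F))) (ZMod m)) (show 1 + 1 = 2 from rfl) :=
  adjointInjective_one_zmod_classData F U hm

end IdeleClassBar

end Literature.NumberTheory.GaloisRepresentations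

end
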